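import Literature.MathematicalPhysics.QuantumLattice.HubbardNNNHoppingEnergyDensityConvex
import Literature.MathematicalPhysics.QuantumLattice.HubbardNNNHoppingEnergyDensityConcave
import HarnessLib

/-!
# Thermodynamic-limit chemical potentials `μ₊`, `μ₋` and the charge gap of the 2D `t–t'` Hubbard model

Topic `MathematicalPhysics/QuantumLattice` (family `hubbard`); namespace
`Literature.MathematicalPhysics.QuantumLattice.ThermodynamicLimit`. Companion of
`HubbardNNNHoppingEnergyDensityConvex.lean` (`convexOn_energyDensityTT'`: for `U ≥ 0` the
thermodynamic-limit ground-state energy density `n ↦ e(t, t', U, n) = energyDensityTT' t t' U n` of the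
square-lattice Hubbard model with nearest (`t`) and next-nearest (`t'`) neighbour hopping is convex on
`[0, 2)`), of `HubbardNNNHoppingEnergyDensityParticleHole.lean` (`energyDensityTT'_particleHole`:
`e(t, t', U, n) = e(t, -t', U, 2 - n) + U (n - 1)`) and of `HubbardNNNHoppingEnergyDensityConcave.lean`
(`energyDensityTT'_one_le_energyDensity2D`: at half filling `e(t, t', U, 1) ≤ e(t, 0, U, 1)`).

Lieb–Wu define the chemical potentials for ADDING and REMOVING one electron, on a finite lattice
`μ₊ ≡ E(M + 1, M; U) - E(M, M; U)`, `μ₋ ≡ E(M, M; U) - E(M - 1, M; U)` (PRL 20 (1968) eq. (21): "If `μ₊`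
and `μ₋` are equal, the system has the property of a conductor. If … `μ₊ > μ₋`, then the system shares
the property of an insulator"; eq. (22): `μ₊ = U - μ₋` for the half-filled band), and in the thermodynamic
limit (Physica A 321 (2003) §7, verbatim): "In the thermodynamic limit we know, by general arguments,
that `E(N)` has the form `E(N) = N_a e(N/N_a)` and `e` is a convex function of `N/N_a`. … A convex
function has right and left derivatives at every point and, therefore, `μ₊ =` right derivative and
`μ₋ =` left derivative are well defined. Convexity implies that `μ₋ ≤ μ₊`. … We learn from [the
hole–particle identity] that `μ₊ + μ₋ = U`"; "The system is conducting if `μ₊ = μ₋` and insulating if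
`μ₊ > μ₋`." This file states exactly these thermodynamic-limit objects for the tree's `energyDensityTT'`
(the `t' = 0` case is the tree's `energyDensity2D`, `energyDensityTT'_zero`):

* `chemPotPlusTT' t t' U n  := derivWithin (energyDensityTT' t t' U) (Ioi n) n`  — `μ₊(n) = e'(n⁺)`;
* `chemPotMinusTT' t t' U n := derivWithin (energyDensityTT' t t' U) (Iio n) n`  — `μ₋(n) = e'(n⁻)`;
* `chargeGapTT' t t' U n    := μ₊(n) - μ₋(n)`  — the thermodynamic-limit charge gap (the jump of the
  chemical potential; Lieb–Wu's insulator criterion is `μ₊ > μ₋`; the AFQMC literature's single-particle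
  gap at half filling is `Δ = (ε_p + ε_h)/2 = (μ₊ - μ₋)/2`, Vitali–Shi–Qin–Zhang (2016) eqs. (28)–(29)).

PROVED here (all for `U ≥ 0`, densities in the open interval `(0, 2)`), from the two landed theorems
and Mathlib's one-sided derivatives of convex functions (`Mathlib.Analysis.Convex.Deriv`):

* existence: `hasDerivWithinAt_chemPotMinusTT'` / `hasDerivWithinAt_chemPotPlusTT'` (the one-sided
  derivatives exist), `chemPotMinusTT'_le_chemPotPlusTT'` (`μ₋ ≤ μ₊`), `chargeGapTT'_nonneg`;
* SECANT BOUNDS (the form certified energy rows are read through):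
  `slope_le_chemPotMinusTT'` — `(e(n) - e(m))/(n - m) ≤ μ₋(n)` for `0 ≤ m < n < 2`;
  `chemPotPlusTT'_le_slope` — `μ₊(n) ≤ (e(p) - e(n))/(p - n)` for `0 < n < p < 2`;
  `chemPotPlusTT'_le_chemPotMinusTT'_of_lt` — `μ₊(m) ≤ μ₋(n)` for `m < n`; monotonicity of `μ±`;
* SUPPORTING LINES with explicit slopes: `e(n) + s (x - n) ≤ e(x)` on `[0, 2)` for every
  `s ∈ [μ₋(n), μ₊(n)]` (`energyDensityTT'_add_mul_le_of_mem_Icc`; one-sided forms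
  `energyDensityTT'_add_chemPotMinusTT'_mul_le` / `energyDensityTT'_add_chemPotPlusTT'_mul_le`);
* PARTICLE–HOLE: `chemPotPlusTT'_add_chemPotMinusTT'_two_sub` —
  `μ₊(t, t', U, n) + μ₋(t, -t', U, 2 - n) = U`; at half filling and `t' = 0`:
  `μ₊(1) + μ₋(1) = U` (`chemPotPlusTT'_add_chemPotMinusTT'_one`), `Δ_c(1) = U - 2 μ₋(1) = 2 μ₊(1) - U`,
  `μ₋(1) ≤ U/2 ≤ μ₊(1)`;
* ROW-SHAPED COROLLARIES (inputs = an energy FLOOR `lo ≤ e(n)` and an energy CEILING `e(m) ≤ hi`,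
  e.g. the cell-certified rows of `Summits/Ventures/CertifiedManyBodySolver`; no certificate is read
  here): `chemPotMinusTT'_ge_of_bounds` (`(lo - hi)/(n - m) ≤ μ₋(n)`), `chemPotPlusTT'_le_of_bounds`,
  and at half filling, `t' = 0`, with `energyDensity2D` hypotheses:
  `chemPotMinusTT'_zero_one_ge_of_bounds`, `chemPotPlusTT'_zero_one_le_of_bounds`,
  `chargeGapTT'_zero_one_le_of_bounds` (`Δ_c(1) ≤ U - 2 (lo - hi)/(1 - m)`); and for ANY `t'` at a
  hole-doped density, `chemPotPlusTT'_le_of_bounds_halfFilling2D` (`μ₊(t,t',U,n) ≤ (hi - lo)/(1 - n)` from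
  a `t'`-floor at `n` and a `t' = 0` half-filling ceiling, via `e(t,t',U,1) ≤ e(t,0,U,1)`).

HONEST LIMITS. No value of `μ±` or `Δ_c` is computed here; a LOWER bound on `Δ_c(1)` (a Mott gap)
does NOT follow from energy bounds and convexity (they give exactly `μ₋(1) ≤ U/2 ≤ μ₊(1)`); the
finite-volume differences `E(M ± 1, M; U) - E(M, M; U)` of Lieb–Wu eq. (21) are not related to the
limit objects in this file. Three definitions with unfolding lemmas; everything else proved; no named fact, no sorry.

## References

* E. H. Lieb, F. Y. Wu, *Absence of Mott transition in an exact solution of the short-range, one-band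
  model in one dimension*, Phys. Rev. Lett. 20 (1968) 1445, eqs. (21)–(22) (`μ₊`, `μ₋`; `μ₊ = U - μ₋`
  for the half-filled band). [cite: LiebWuPRL1968, eqs. (21)–(22)]
* E. H. Lieb, F. Y. Wu, *The one-dimensional Hubbard model: a reminiscence*, Physica A 321 (2003)
  1–27, §7 (thermodynamic limit: `e` convex, `μ₊`/`μ₋` = right/left derivative, `μ₋ ≤ μ₊`,
  `μ₊ + μ₋ = U`, insulating iff `μ₊ > μ₋`) and §1 eq. (3) (hole–particle identity).
  [cite: LiebWuPhysicaA2003, §7]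
* D. Ruelle, *Statistical Mechanics: Rigorous Results* (1969), §3.3–§3.4 (existence and convexity of
  the limiting energy density in the density). [cite: Ruelle1969, §3.3]
* E. Vitali, H. Shi, M. Qin, S. Zhang, Phys. Rev. B 94 (2016) 085140, eqs. (28)–(29) (the charge gap
  of the 2D Hubbard model from addition/removal energies). [cite: VitaliShiQinZhang2016, eqs. (28)–(29)]
-/

noncomputable section

namespace Literature.MathematicalPhysics.QuantumLattice

open Set Filter Topology

namespace ThermodynamicLimit

/-! ### The objects -/

/-- **`μ₊(n)`, the chemical potential for ADDING an electron** at density `n` in the thermodynamic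
limit of the square-lattice `t–t'` Hubbard model: the RIGHT derivative at `n` of the convex energy
density `x ↦ energyDensityTT' t t' U x` (Lieb–Wu 2003 §7: "`μ₊ =` right derivative"; finite-volume
ancestor `μ₊ ≡ E(M+1, M; U) - E(M, M; U)`, Lieb–Wu 1968 eq. (21)). Meaningful for `U ≥ 0`, `0 < n < 2`
(`hasDerivWithinAt_chemPotPlusTT'`); junk (Mathlib's default `0`) where the one-sided derivative does
not exist. [cite: LiebWuPhysicaA2003, §7] [cite: LiebWuPRL1968, eq. (21)] -/
def chemPotPlusTT' (t t' U n : ℝ) : ℝ :=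
  derivWithin (energyDensityTT' t t' U) (Ioi n) n

/-- **`μ₋(n)`, the chemical potential for REMOVING an electron** at density `n` in the thermodynamic
limit of the square-lattice `t–t'` Hubbard model: the LEFT derivative at `n` of
`x ↦ energyDensityTT' t t' U x` (Lieb–Wu 2003 §7: "`μ₋ =` left derivative"; finite-volume ancestor
`μ₋ ≡ E(M, M; U) - E(M-1, M; U)`, Lieb–Wu 1968 eq. (21)). [cite: LiebWuPhysicaA2003, §7]
[cite: LiebWuPRL1968, eq. (21)] -/
def chemPotMinusTT' (t t' U n : ℝ) : ℝ :=
  derivWithin (energyDensityTT' t t' U) (Iio n) n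

/-- **The thermodynamic-limit charge gap `Δ_c(n) = μ₊(n) - μ₋(n)`** of the square-lattice `t–t'`
Hubbard model at density `n`: the jump of the chemical potential (Lieb–Wu 2003 §7: "The system is
conducting if `μ₊ = μ₋` and insulating if `μ₊ > μ₋`"). Convention: the single-particle gap of the AFQMC
literature at half filling is `Δ = (ε_p + ε_h)/2 = Δ_c/2` (Vitali–Shi–Qin–Zhang 2016 eqs. (28)–(29)).
[cite: LiebWuPhysicaA2003, §7] [cite: VitaliShiQinZhang2016, eqs. (28)–(29)] -/
def chargeGapTT' (t t' U n : ℝ) : ℝ :=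
  chemPotPlusTT' t t' U n - chemPotMinusTT' t t' U n

/-- Unfolding lemma: `μ₊(n) = derivWithin e (Ioi n) n`. [cite: LiebWuPhysicaA2003, §7] -/
theorem chemPotPlusTT'_def (t t' U n : ℝ) :
    chemPotPlusTT' t t' U n = derivWithin (energyDensityTT' t t' U) (Ioi n) n := rfl

/-- Unfolding lemma: `μ₋(n) = derivWithin e (Iio n) n`. [cite: LiebWuPhysicaA2003, §7] -/
theorem chemPotMinusTT'_def (t t' U n : ℝ) :
    chemPotMinusTT' t t' U n = derivWithin (energyDensityTT' t t' U) (Iio n) n := rfl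

/-- Unfolding lemma: `Δ_c(n) = μ₊(n) - μ₋(n)`. [cite: LiebWuPhysicaA2003, §7] -/
theorem chargeGapTT'_def (t t' U n : ℝ) :
    chargeGapTT' t t' U n = chemPotPlusTT' t t' U n - chemPotMinusTT' t t' U n := rfl

/-- `t' = 0`: the energy density is the tree's `energyDensity2D` as a function of the density
(`energyDensityTT'_zero`, pointwise). [cite: Ruelle1969, §3.3] -/
theorem energyDensityTT'_zero_eq (t U : ℝ) : energyDensityTT' t 0 U = energyDensity2D t U :=
  funext (energyDensityTT'_zero t U)

/-- `t' = 0`: `μ₊(n)` is the right derivative of `energyDensity2D t U` at `n`.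
[cite: LiebWuPhysicaA2003, §7] -/
theorem chemPotPlusTT'_zero (t U n : ℝ) :
    chemPotPlusTT' t 0 U n = derivWithin (energyDensity2D t U) (Ioi n) n := by
  rw [chemPotPlusTT', energyDensityTT'_zero_eq]

/-- `t' = 0`: `μ₋(n)` is the left derivative of `energyDensity2D t U` at `n`.
[cite: LiebWuPhysicaA2003, §7] -/
theorem chemPotMinusTT'_zero (t U n : ℝ) :
    chemPotMinusTT' t 0 U n = derivWithin (energyDensity2D t U) (Iio n) n := by
  rw [chemPotMinusTT', energyDensityTT'_zero_eq]

/-! ### Existence and ordering of the one-sided derivatives (convexity) -/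

/-- A density `0 < n < 2` is interior to the convexity domain `[0, 2)`. [cite: Ruelle1969, §3.3] -/
theorem mem_interior_Ico_zero_two {n : ℝ} (hn0 : 0 < n) (hn2 : n < 2) :
    n ∈ interior (Ico (0 : ℝ) 2) := by
  rw [interior_Ico]; exact ⟨hn0, hn2⟩

/-- **`μ₋(n)` exists**: the energy density has left derivative `μ₋(n)` at every `0 < n < 2`
(`U ≥ 0`; "a convex function has right and left derivatives at every point", Lieb–Wu 2003 §7).
[cite: LiebWuPhysicaA2003, §7] -/
theorem hasDerivWithinAt_chemPotMinusTT' (t t' : ℝ) {U : ℝ} (hU : 0 ≤ U) {n : ℝ} (hn0 : 0 < n)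
    (hn2 : n < 2) :
    HasDerivWithinAt (energyDensityTT' t t' U) (chemPotMinusTT' t t' U n) (Iio n) n :=
  (convexOn_energyDensityTT' t t' hU).hasDerivWithinAt_leftDeriv_of_mem_interior
    (mem_interior_Ico_zero_two hn0 hn2)

/-- **`μ₊(n)` exists**: the energy density has right derivative `μ₊(n)` at every `0 < n < 2`
(`U ≥ 0`). [cite: LiebWuPhysicaA2003, §7] -/
theorem hasDerivWithinAt_chemPotPlusTT' (t t' : ℝ) {U : ℝ} (hU : 0 ≤ U) {n : ℝ} (hn0 : 0 < n)
    (hn2 : n < 2) :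
    HasDerivWithinAt (energyDensityTT' t t' U) (chemPotPlusTT' t t' U n) (Ioi n) n :=
  (convexOn_energyDensityTT' t t' hU).hasDerivWithinAt_rightDeriv_of_mem_interior
    (mem_interior_Ico_zero_two hn0 hn2)

/-- **`μ₋(n) ≤ μ₊(n)`** ("Convexity implies that `μ₋ ≤ μ₊`", Lieb–Wu 2003 §7), `U ≥ 0`, `0 < n < 2`.
[cite: LiebWuPhysicaA2003, §7] -/
theorem chemPotMinusTT'_le_chemPotPlusTT' (t t' : ℝ) {U : ℝ} (hU : 0 ≤ U) {n : ℝ} (hn0 : 0 < n)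
    (hn2 : n < 2) :
    chemPotMinusTT' t t' U n ≤ chemPotPlusTT' t t' U n :=
  (convexOn_energyDensityTT' t t' hU).leftDeriv_le_rightDeriv_of_mem_interior
    (mem_interior_Ico_zero_two hn0 hn2)

/-- **The charge gap is nonnegative**: `0 ≤ Δ_c(n)` (`U ≥ 0`, `0 < n < 2`).
[cite: LiebWuPhysicaA2003, §7] -/
theorem chargeGapTT'_nonneg (t t' : ℝ) {U : ℝ} (hU : 0 ≤ U) {n : ℝ} (hn0 : 0 < n) (hn2 : n < 2) :
    0 ≤ chargeGapTT' t t' U n :=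
  sub_nonneg.2 (chemPotMinusTT'_le_chemPotPlusTT' t t' hU hn0 hn2)

/-! ### Secant bounds -/

/-- **Backward secant ≤ `μ₋`**: `(e(n) - e(m))/(n - m) ≤ μ₋(n)` for `0 ≤ m < n < 2`, `U ≥ 0` (the
left derivative of a convex function dominates every secant slope from the left).
[cite: LiebWuPhysicaA2003, §7] -/
theorem slope_le_chemPotMinusTT' (t t' : ℝ) {U : ℝ} (hU : 0 ≤ U) {m n : ℝ} (hm0 : 0 ≤ m)
    (hmn : m < n) (hn2 : n < 2) :
    (energyDensityTT' t t' U n - energyDensityTT' t t' U m) / (n - m) ≤ chemPotMinusTT' t t' U n := by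
  have h := (convexOn_energyDensityTT' t t' hU).slope_le_leftDeriv_of_mem_interior
    (show m ∈ Ico (0 : ℝ) 2 from ⟨hm0, hmn.trans hn2⟩)
    (mem_interior_Ico_zero_two (hm0.trans_lt hmn) hn2) hmn
  rwa [slope_def_field] at h

/-- **`μ₊` ≤ forward secant**: `μ₊(n) ≤ (e(p) - e(n))/(p - n)` for `0 < n < p < 2`, `U ≥ 0`.
[cite: LiebWuPhysicaA2003, §7] -/
theorem chemPotPlusTT'_le_slope (t t' : ℝ) {U : ℝ} (hU : 0 ≤ U) {n p : ℝ} (hn0 : 0 < n)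
    (hnp : n < p) (hp2 : p < 2) :
    chemPotPlusTT' t t' U n ≤ (energyDensityTT' t t' U p - energyDensityTT' t t' U n) / (p - n) := by
  have h := (convexOn_energyDensityTT' t t' hU).rightDeriv_le_slope_of_mem_interior
    (mem_interior_Ico_zero_two hn0 (hnp.trans hp2))
    (show p ∈ Ico (0 : ℝ) 2 from ⟨(hn0.trans hnp).le, hp2⟩) hnp
  rwa [slope_def_field] at h

/-- **`μ₊(m) ≤ μ₋(n)` for `m < n`** (both sandwich the secant over `[m, n]`), `0 < m < n < 2`,
`U ≥ 0`: the chemical potential is non-decreasing across densities. [cite: LiebWuPhysicaA2003, §7] -/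
theorem chemPotPlusTT'_le_chemPotMinusTT'_of_lt (t t' : ℝ) {U : ℝ} (hU : 0 ≤ U) {m n : ℝ}
    (hm0 : 0 < m) (hmn : m < n) (hn2 : n < 2) :
    chemPotPlusTT' t t' U m ≤ chemPotMinusTT' t t' U n :=
  (chemPotPlusTT'_le_slope t t' hU hm0 hmn hn2).trans (slope_le_chemPotMinusTT' t t' hU hm0.le hmn hn2)

/-- **`μ₋` is non-decreasing in the density** on `(0, 2)` (`U ≥ 0`). [cite: LiebWuPhysicaA2003, §7] -/
theorem monotoneOn_chemPotMinusTT' (t t' : ℝ) {U : ℝ} (hU : 0 ≤ U) :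
    MonotoneOn (chemPotMinusTT' t t' U) (Ioo (0 : ℝ) 2) := by
  have h := (convexOn_energyDensityTT' t t' hU).monotoneOn_leftDeriv
  rw [interior_Ico] at h
  exact h

/-- **`μ₊` is non-decreasing in the density** on `(0, 2)` (`U ≥ 0`). [cite: LiebWuPhysicaA2003, §7] -/
theorem monotoneOn_chemPotPlusTT' (t t' : ℝ) {U : ℝ} (hU : 0 ≤ U) :
    MonotoneOn (chemPotPlusTT' t t' U) (Ioo (0 : ℝ) 2) := by
  have h := (convexOn_energyDensityTT' t t' hU).monotoneOn_rightDeriv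
  rw [interior_Ico] at h
  exact h

/-- `μ₋(m) ≤ μ₋(n)` for `0 < m ≤ n < 2` (pointwise form of `monotoneOn_chemPotMinusTT'`).
[cite: LiebWuPhysicaA2003, §7] -/
theorem chemPotMinusTT'_mono (t t' : ℝ) {U : ℝ} (hU : 0 ≤ U) {m n : ℝ} (hm0 : 0 < m) (hmn : m ≤ n)
    (hn2 : n < 2) :
    chemPotMinusTT' t t' U m ≤ chemPotMinusTT' t t' U n :=
  monotoneOn_chemPotMinusTT' t t' hU ⟨hm0, lt_of_le_of_lt hmn hn2⟩ ⟨hm0.trans_le hmn, hn2⟩ hmn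

/-- `μ₊(m) ≤ μ₊(n)` for `0 < m ≤ n < 2` (pointwise form of `monotoneOn_chemPotPlusTT'`).
[cite: LiebWuPhysicaA2003, §7] -/
theorem chemPotPlusTT'_mono (t t' : ℝ) {U : ℝ} (hU : 0 ≤ U) {m n : ℝ} (hm0 : 0 < m) (hmn : m ≤ n)
    (hn2 : n < 2) :
    chemPotPlusTT' t t' U m ≤ chemPotPlusTT' t t' U n :=
  monotoneOn_chemPotPlusTT' t t' hU ⟨hm0, lt_of_le_of_lt hmn hn2⟩ ⟨hm0.trans_le hmn, hn2⟩ hmn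

/-! ### Supporting lines with explicit slopes -/

/-- **Supporting line to the LEFT with slope `μ₋(n)`**: `e(n) + μ₋(n) (x - n) ≤ e(x)` for
`0 ≤ x ≤ n`, `0 < n < 2`, `U ≥ 0` (the secant bound `slope_le_chemPotMinusTT'` rearranged; the
explicit-slope form of `exists_supporting_line_energyDensityTT'`). [cite: Ruelle1969, §3.4]
[cite: LiebWuPhysicaA2003, §7] -/
theorem energyDensityTT'_add_chemPotMinusTT'_mul_le (t t' : ℝ) {U : ℝ} (hU : 0 ≤ U) {x n : ℝ}
    (hx0 : 0 ≤ x) (hxn : x ≤ n) (hn0 : 0 < n) (hn2 : n < 2) :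
    energyDensityTT' t t' U n + chemPotMinusTT' t t' U n * (x - n) ≤ energyDensityTT' t t' U x := by
  rcases eq_or_lt_of_le hxn with rfl | hlt
  · simp
  · have h := slope_le_chemPotMinusTT' t t' hU hx0 hlt hn2
    rw [div_le_iff₀ (sub_pos.2 hlt)] at h
    nlinarith [h]

/-- **Supporting line to the RIGHT with slope `μ₊(n)`**: `e(n) + μ₊(n) (x - n) ≤ e(x)` for
`0 < n ≤ x < 2`, `U ≥ 0`. [cite: Ruelle1969, §3.4] [cite: LiebWuPhysicaA2003, §7] -/
theorem energyDensityTT'_add_chemPotPlusTT'_mul_le (t t' : ℝ) {U : ℝ} (hU : 0 ≤ U) {x n : ℝ}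
    (hn0 : 0 < n) (hnx : n ≤ x) (hx2 : x < 2) :
    energyDensityTT' t t' U n + chemPotPlusTT' t t' U n * (x - n) ≤ energyDensityTT' t t' U x := by
  rcases eq_or_lt_of_le hnx with rfl | hlt
  · simp
  · have h := chemPotPlusTT'_le_slope t t' hU hn0 hlt hx2
    rw [le_div_iff₀ (sub_pos.2 hlt)] at h
    nlinarith [h]

/-- **Every slope between `μ₋(n)` and `μ₊(n)` supports the energy density at `n`**:
`e(n) + s (x - n) ≤ e(x)` for all `x ∈ [0, 2)` whenever `μ₋(n) ≤ s ≤ μ₊(n)` (`0 < n < 2`, `U ≥ 0`) —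
the subdifferential of the convex energy density at `n` contains `[μ₋(n), μ₊(n)]` (the chemical
potentials at which a state of density `n` is a grand-canonical minimiser). [cite: Ruelle1969, §3.4]
[cite: LiebWuPhysicaA2003, §7] -/
theorem energyDensityTT'_add_mul_le_of_mem_Icc (t t' : ℝ) {U : ℝ} (hU : 0 ≤ U) {n s x : ℝ}
    (hn0 : 0 < n) (hn2 : n < 2) (hs₁ : chemPotMinusTT' t t' U n ≤ s) (hs₂ : s ≤ chemPotPlusTT' t t' U n)
    (hx0 : 0 ≤ x) (hx2 : x < 2) :
    energyDensityTT' t t' U n + s * (x - n) ≤ energyDensityTT' t t' U x := by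
  rcases le_or_gt x n with hxn | hnx
  · have h := energyDensityTT'_add_chemPotMinusTT'_mul_le t t' hU hx0 hxn hn0 hn2
    nlinarith [h, hs₁, hxn]
  · have h := energyDensityTT'_add_chemPotPlusTT'_mul_le t t' hU hn0 hnx.le hx2
    nlinarith [h, hs₂, hnx]

/-! ### Particle–hole symmetry -/

/-- **Particle–hole relation of the chemical potentials**:
`μ₊(t, t', U, n) + μ₋(t, -t', U, 2 - n) = U` for `U ≥ 0`, `0 < n < 2` — differentiate the
hole–particle identity `e(t, t', U, x) = e(t, -t', U, 2 - x) + U (x - 1)`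
(`energyDensityTT'_particleHole`) from the right at `n`. The thermodynamic-limit form of Lieb–Wu's
`μ₊ + μ₋ = U` ("We learn from [the hole–particle identity] that `μ₊ + μ₋ = U`", 2003 §7; 1968
eq. (22)), here with the sign flip `t' ↦ -t'` of the non-bipartite diagonal hopping.
[cite: LiebWuPhysicaA2003, §7] [cite: LiebWuPRL1968, eq. (22)] -/
theorem chemPotPlusTT'_add_chemPotMinusTT'_two_sub (t t' : ℝ) {U : ℝ} (hU : 0 ≤ U) {n : ℝ}
    (hn0 : 0 < n) (hn2 : n < 2) :
    chemPotPlusTT' t t' U n + chemPotMinusTT' t (-t') U (2 - n) = U := by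
  have h2n0 : 0 < 2 - n := by linarith
  have h2n2 : 2 - n < 2 := by linarith
  -- the left derivative of `x ↦ e(t, -t', U, x)` at `2 - n`
  have hg := hasDerivWithinAt_chemPotMinusTT' t (-t') hU h2n0 h2n2
  -- the reflection `x ↦ 2 - x` maps `(n, ∞)` into `(-∞, 2 - n)`
  have hh : HasDerivWithinAt (fun x : ℝ => 2 - x) (-1) (Ioi n) n :=
    ((hasDerivAt_id' n).const_sub (2 : ℝ)).hasDerivWithinAt
  have hmaps : MapsTo (fun x : ℝ => 2 - x) (Ioi n) (Iio (2 - n)) := by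
    intro x hx
    simp only [mem_Ioi, mem_Iio] at hx ⊢
    linarith
  have hcomp : HasDerivWithinAt (fun x : ℝ => energyDensityTT' t (-t') U (2 - x))
      (chemPotMinusTT' t (-t') U (2 - n) * (-1)) (Ioi n) n :=
    hg.comp_of_eq n hh hmaps (by simp)
  have hlin : HasDerivWithinAt (fun x : ℝ => U * (x - 1)) (U * 1) (Ioi n) n :=
    (((hasDerivAt_id n).sub_const (1 : ℝ)).const_mul U).hasDerivWithinAt
  have hF := hcomp.add hlin
  -- `e(t, t', U, ·)` agrees with the reflected function near `n` from the right
  have heq : energyDensityTT' t t' U =ᶠ[𝓝[Ioi n] n]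
      fun x : ℝ => energyDensityTT' t (-t') U (2 - x) + U * (x - 1) := by
    filter_upwards [Ioo_mem_nhdsGT hn2] with x hx
    exact energyDensityTT'_particleHole t t' hU (hn0.trans hx.1) hx.2
  have hn_eq : energyDensityTT' t t' U n = energyDensityTT' t (-t') U (2 - n) + U * (n - 1) :=
    energyDensityTT'_particleHole t t' hU hn0 hn2
  have hderiv := hF.congr_of_eventuallyEq heq hn_eq
  have hval := hderiv.derivWithin (uniqueDiffWithinAt_Ioi n)
  rw [chemPotPlusTT', hval]
  ring

/-- The same identity read at `-t'`: `μ₋(t, t', U, n) + μ₊(t, -t', U, 2 - n) = U` (`U ≥ 0`,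
`0 < n < 2`). [cite: LiebWuPhysicaA2003, §7] -/
theorem chemPotMinusTT'_add_chemPotPlusTT'_two_sub (t t' : ℝ) {U : ℝ} (hU : 0 ≤ U) {n : ℝ}
    (hn0 : 0 < n) (hn2 : n < 2) :
    chemPotMinusTT' t t' U n + chemPotPlusTT' t (-t') U (2 - n) = U := by
  have h := chemPotPlusTT'_add_chemPotMinusTT'_two_sub t (-t') hU (n := 2 - n) (by linarith)
    (by linarith)
  rw [neg_neg, show (2 : ℝ) - (2 - n) = n by ring] at h
  linarith

/-- **The charge gap is particle–hole symmetric up to `t' ↦ -t'`**: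
`Δ_c(t, t', U, n) = Δ_c(t, -t', U, 2 - n)` (`U ≥ 0`, `0 < n < 2`). [cite: LiebWuPhysicaA2003, §7] -/
theorem chargeGapTT'_two_sub (t t' : ℝ) {U : ℝ} (hU : 0 ≤ U) {n : ℝ} (hn0 : 0 < n) (hn2 : n < 2) :
    chargeGapTT' t (-t') U (2 - n) = chargeGapTT' t t' U n := by
  have h1 := chemPotPlusTT'_add_chemPotMinusTT'_two_sub t t' hU hn0 hn2
  have h2 := chemPotMinusTT'_add_chemPotPlusTT'_two_sub t t' hU hn0 hn2
  rw [chargeGapTT', chargeGapTT']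
  linarith

/-- **Half filling**: `μ₊(t, t', U, 1) + μ₋(t, -t', U, 1) = U` (`U ≥ 0`).
[cite: LiebWuPhysicaA2003, §7] [cite: LiebWuPRL1968, eq. (22)] -/
theorem chemPotPlusTT'_one_add_chemPotMinusTT'_neg_one (t t' : ℝ) {U : ℝ} (hU : 0 ≤ U) :
    chemPotPlusTT' t t' U 1 + chemPotMinusTT' t (-t') U 1 = U := by
  have h := chemPotPlusTT'_add_chemPotMinusTT'_two_sub t t' hU (n := 1) one_pos one_lt_two
  rwa [show (2 : ℝ) - 1 = 1 by norm_num] at h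

/-- **Half filling, any `t'`: `Δ_c(t, t', U, 1) = U - μ₋(t, t', U, 1) - μ₋(t, -t', U, 1)`** (the
charge gap at half filling from the two REMOVAL chemical potentials at `±t'`; `U ≥ 0`).
[cite: LiebWuPhysicaA2003, §7] -/
theorem chargeGapTT'_one_eq (t t' : ℝ) {U : ℝ} (hU : 0 ≤ U) :
    chargeGapTT' t t' U 1 = U - chemPotMinusTT' t t' U 1 - chemPotMinusTT' t (-t') U 1 := by
  have h := chemPotPlusTT'_one_add_chemPotMinusTT'_neg_one t t' hU
  rw [chargeGapTT']
  linarith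

/-- **Half filling, `t' = 0`: `μ₊(1) + μ₋(1) = U`** — Lieb–Wu's relation (1968 eq. (22),
2003 §7) for the square lattice (`U ≥ 0`). [cite: LiebWuPRL1968, eq. (22)] [cite: LiebWuPhysicaA2003, §7] -/
theorem chemPotPlusTT'_add_chemPotMinusTT'_one (t : ℝ) {U : ℝ} (hU : 0 ≤ U) :
    chemPotPlusTT' t 0 U 1 + chemPotMinusTT' t 0 U 1 = U := by
  have h := chemPotPlusTT'_one_add_chemPotMinusTT'_neg_one t 0 hU
  rwa [neg_zero] at h

/-- **Half filling, `t' = 0`: `Δ_c(1) = U - 2 μ₋(1)`** (`U ≥ 0`). [cite: LiebWuPhysicaA2003, §7] -/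
theorem chargeGapTT'_one_eq_sub_two_mul (t : ℝ) {U : ℝ} (hU : 0 ≤ U) :
    chargeGapTT' t 0 U 1 = U - 2 * chemPotMinusTT' t 0 U 1 := by
  have h := chemPotPlusTT'_add_chemPotMinusTT'_one t hU
  rw [chargeGapTT']
  linarith

/-- **Half filling, `t' = 0`: `Δ_c(1) = 2 μ₊(1) - U`** (`U ≥ 0`). [cite: LiebWuPhysicaA2003, §7] -/
theorem chargeGapTT'_one_eq_two_mul_sub (t : ℝ) {U : ℝ} (hU : 0 ≤ U) :
    chargeGapTT' t 0 U 1 = 2 * chemPotPlusTT' t 0 U 1 - U := by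
  have h := chemPotPlusTT'_add_chemPotMinusTT'_one t hU
  rw [chargeGapTT']
  linarith

/-- **Half filling, `t' = 0`: `μ₋(1) ≤ U/2`** (from `μ₋ ≤ μ₊` and `μ₊ + μ₋ = U`; Lieb–Wu 2003 §7
"`μ₊ > μ₋` if `μ₋ < U/2`"). [cite: LiebWuPhysicaA2003, §7] -/
theorem chemPotMinusTT'_one_le_half (t : ℝ) {U : ℝ} (hU : 0 ≤ U) :
    chemPotMinusTT' t 0 U 1 ≤ U / 2 := by
  have h1 := chemPotPlusTT'_add_chemPotMinusTT'_one t hU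
  have h2 := chemPotMinusTT'_le_chemPotPlusTT' t 0 hU (n := 1) one_pos one_lt_two
  linarith

/-- **Half filling, `t' = 0`: `U/2 ≤ μ₊(1)`**. [cite: LiebWuPhysicaA2003, §7] -/
theorem half_le_chemPotPlusTT'_one (t : ℝ) {U : ℝ} (hU : 0 ≤ U) :
    U / 2 ≤ chemPotPlusTT' t 0 U 1 := by
  have h1 := chemPotPlusTT'_add_chemPotMinusTT'_one t hU
  have h2 := chemPotMinusTT'_le_chemPotPlusTT' t 0 hU (n := 1) one_pos one_lt_two
  linarith

/-- **Lieb–Wu's insulator criterion at half filling, `t' = 0`**: `Δ_c(1) > 0 ↔ μ₋(1) < U/2`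
("hence `μ₊ > μ₋` if `μ₋ < U/2`", Lieb–Wu 2003 §7), `U ≥ 0`. [cite: LiebWuPhysicaA2003, §7] -/
theorem chargeGapTT'_one_pos_iff (t : ℝ) {U : ℝ} (hU : 0 ≤ U) :
    0 < chargeGapTT' t 0 U 1 ↔ chemPotMinusTT' t 0 U 1 < U / 2 := by
  rw [chargeGapTT'_one_eq_sub_two_mul t hU]
  constructor <;> intro h <;> linarith

/-! ### Row-shaped corollaries: chemical-potential and charge-gap bounds from energy bounds -/

/-- **`μ₋` FLOOR from an energy floor at `n` and an energy ceiling at `m < n`**: if `lo ≤ e(n)` and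
`e(m) ≤ hi` (`0 ≤ m < n < 2`, `U ≥ 0`) then `(lo - hi)/(n - m) ≤ μ₋(n)`. (E.g. a certified
thermodynamic-limit LOWER bound at half filling and a certified UPPER bound at a hole-doped density.)
[cite: LiebWuPhysicaA2003, §7] -/
theorem chemPotMinusTT'_ge_of_bounds (t t' : ℝ) {U : ℝ} (hU : 0 ≤ U) {m n lo hi : ℝ} (hm0 : 0 ≤ m)
    (hmn : m < n) (hn2 : n < 2) (hlo : lo ≤ energyDensityTT' t t' U n)
    (hhi : energyDensityTT' t t' U m ≤ hi) :
    (lo - hi) / (n - m) ≤ chemPotMinusTT' t t' U n := by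
  refine le_trans ?_ (slope_le_chemPotMinusTT' t t' hU hm0 hmn hn2)
  exact div_le_div_of_nonneg_right (by linarith) (by linarith)

/-- **`μ₊` FLOOR** from the same data (`μ₋(n) ≤ μ₊(n)`): `(lo - hi)/(n - m) ≤ μ₊(n)`.
[cite: LiebWuPhysicaA2003, §7] -/
theorem chemPotPlusTT'_ge_of_bounds (t t' : ℝ) {U : ℝ} (hU : 0 ≤ U) {m n lo hi : ℝ} (hm0 : 0 ≤ m)
    (hmn : m < n) (hn2 : n < 2) (hlo : lo ≤ energyDensityTT' t t' U n)
    (hhi : energyDensityTT' t t' U m ≤ hi) :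
    (lo - hi) / (n - m) ≤ chemPotPlusTT' t t' U n :=
  (chemPotMinusTT'_ge_of_bounds t t' hU hm0 hmn hn2 hlo hhi).trans
    (chemPotMinusTT'_le_chemPotPlusTT' t t' hU (hm0.trans_lt hmn) hn2)

/-- **`μ₊` CEILING from an energy floor at `n` and an energy ceiling at `p > n`**: if `lo ≤ e(n)` and
`e(p) ≤ hi` (`0 < n < p < 2`, `U ≥ 0`) then `μ₊(n) ≤ (hi - lo)/(p - n)`.
[cite: LiebWuPhysicaA2003, §7] -/
theorem chemPotPlusTT'_le_of_bounds (t t' : ℝ) {U : ℝ} (hU : 0 ≤ U) {n p lo hi : ℝ} (hn0 : 0 < n)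
    (hnp : n < p) (hp2 : p < 2) (hlo : lo ≤ energyDensityTT' t t' U n)
    (hhi : energyDensityTT' t t' U p ≤ hi) :
    chemPotPlusTT' t t' U n ≤ (hi - lo) / (p - n) := by
  refine (chemPotPlusTT'_le_slope t t' hU hn0 hnp hp2).trans ?_
  exact div_le_div_of_nonneg_right (by linarith) (by linarith)

/-- **`μ₋` CEILING** from the same data (`μ₋(n) ≤ μ₊(n)`): `μ₋(n) ≤ (hi - lo)/(p - n)`.
[cite: LiebWuPhysicaA2003, §7] -/
theorem chemPotMinusTT'_le_of_bounds (t t' : ℝ) {U : ℝ} (hU : 0 ≤ U) {n p lo hi : ℝ} (hn0 : 0 < n)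
    (hnp : n < p) (hp2 : p < 2) (hlo : lo ≤ energyDensityTT' t t' U n)
    (hhi : energyDensityTT' t t' U p ≤ hi) :
    chemPotMinusTT' t t' U n ≤ (hi - lo) / (p - n) :=
  (chemPotMinusTT'_le_chemPotPlusTT' t t' hU hn0 (hnp.trans hp2)).trans
    (chemPotPlusTT'_le_of_bounds t t' hU hn0 hnp hp2 hlo hhi)

/-- **`μ₊` CEILING at a hole-doped density, ANY `t'`, from a square-lattice half-filling
ceiling**: `lo ≤ e(t, t', U, n)` (`0 < n < 1`) and `energyDensity2D t U 1 ≤ hi` give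
`μ₊(t, t', U, n) ≤ (hi - lo)/(1 - n)`, because `e(t, t', U, 1) ≤ energyDensity2D t U 1` for every `t'`
(`energyDensityTT'_one_le_energyDensity2D`: the half-filled density is concave and even in `t'`). (E.g. a
certified `t' ≠ 0` floor at `n = 7/8` and a certified `t' = 0` ceiling at half filling.)
[cite: LiebWuPhysicaA2003, §7] -/
theorem chemPotPlusTT'_le_of_bounds_halfFilling2D (t t' : ℝ) {U : ℝ} (hU : 0 ≤ U) {n lo hi : ℝ}
    (hn0 : 0 < n) (hn1 : n < 1) (hlo : lo ≤ energyDensityTT' t t' U n)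
    (hhi : energyDensity2D t U 1 ≤ hi) :
    chemPotPlusTT' t t' U n ≤ (hi - lo) / (1 - n) :=
  chemPotPlusTT'_le_of_bounds t t' hU hn0 hn1 one_lt_two hlo
    ((energyDensityTT'_one_le_energyDensity2D t t' hU).trans hhi)

/-- **`μ₋` CEILING at a hole-doped density, ANY `t'`**, from the same two bounds (`μ₋ ≤ μ₊`):
`μ₋(t, t', U, n) ≤ (hi - lo)/(1 - n)`. [cite: LiebWuPhysicaA2003, §7] -/
theorem chemPotMinusTT'_le_of_bounds_halfFilling2D (t t' : ℝ) {U : ℝ} (hU : 0 ≤ U) {n lo hi : ℝ}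
    (hn0 : 0 < n) (hn1 : n < 1) (hlo : lo ≤ energyDensityTT' t t' U n)
    (hhi : energyDensity2D t U 1 ≤ hi) :
    chemPotMinusTT' t t' U n ≤ (hi - lo) / (1 - n) :=
  (chemPotMinusTT'_le_chemPotPlusTT' t t' hU hn0 (hn1.trans one_lt_two)).trans
    (chemPotPlusTT'_le_of_bounds_halfFilling2D t t' hU hn0 hn1 hlo hhi)

/-- **Half filling, `t' = 0`, `μ₋` FLOOR read from `energyDensity2D` bounds**: `lo ≤ e(1)` and
`e(m) ≤ hi` for a hole-doped density `0 ≤ m < 1` give `(lo - hi)/(1 - m) ≤ μ₋(1)` (`U ≥ 0`).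
[cite: LiebWuPhysicaA2003, §7] -/
theorem chemPotMinusTT'_zero_one_ge_of_bounds (t : ℝ) {U : ℝ} (hU : 0 ≤ U) {m lo hi : ℝ}
    (hm0 : 0 ≤ m) (hm1 : m < 1) (hlo : lo ≤ energyDensity2D t U 1)
    (hhi : energyDensity2D t U m ≤ hi) :
    (lo - hi) / (1 - m) ≤ chemPotMinusTT' t 0 U 1 :=
  chemPotMinusTT'_ge_of_bounds t 0 hU hm0 hm1 one_lt_two (by rwa [energyDensityTT'_zero])
    (by rwa [energyDensityTT'_zero])

/-- **Half filling, `t' = 0`, `μ₊` CEILING by particle–hole symmetry**: the same two bounds give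
`μ₊(1) = U - μ₋(1) ≤ U - (lo - hi)/(1 - m)` (`U ≥ 0`). [cite: LiebWuPhysicaA2003, §7] -/
theorem chemPotPlusTT'_zero_one_le_of_bounds (t : ℝ) {U : ℝ} (hU : 0 ≤ U) {m lo hi : ℝ}
    (hm0 : 0 ≤ m) (hm1 : m < 1) (hlo : lo ≤ energyDensity2D t U 1)
    (hhi : energyDensity2D t U m ≤ hi) :
    chemPotPlusTT' t 0 U 1 ≤ U - (lo - hi) / (1 - m) := by
  have h1 := chemPotMinusTT'_zero_one_ge_of_bounds t hU hm0 hm1 hlo hhi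
  have h2 := chemPotPlusTT'_add_chemPotMinusTT'_one t hU
  linarith

/-- **Half filling, `t' = 0`, charge-gap CEILING**: `lo ≤ e(1)` and `e(m) ≤ hi` (`0 ≤ m < 1`) give
`Δ_c(1) = U - 2 μ₋(1) ≤ U - 2 (lo - hi)/(1 - m)` (`U ≥ 0`). No charge-gap FLOOR follows from energy
bounds (honest limit: convexity and particle–hole symmetry give exactly `μ₋(1) ≤ U/2 ≤ μ₊(1)`).
[cite: LiebWuPhysicaA2003, §7] -/
theorem chargeGapTT'_zero_one_le_of_bounds (t : ℝ) {U : ℝ} (hU : 0 ≤ U) {m lo hi : ℝ}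
    (hm0 : 0 ≤ m) (hm1 : m < 1) (hlo : lo ≤ energyDensity2D t U 1)
    (hhi : energyDensity2D t U m ≤ hi) :
    chargeGapTT' t 0 U 1 ≤ U - 2 * ((lo - hi) / (1 - m)) := by
  have h1 := chemPotMinusTT'_zero_one_ge_of_bounds t hU hm0 hm1 hlo hhi
  rw [chargeGapTT'_one_eq_sub_two_mul t hU]
  linarith

/-- **Half filling, `t' = 0`, `μ₊` CEILING from an electron-doped ceiling**: `lo ≤ e(1)` and
`e(p) ≤ hi` for `1 < p < 2` give `μ₊(1) ≤ (hi - lo)/(p - 1)` (`U ≥ 0`).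
[cite: LiebWuPhysicaA2003, §7] -/
theorem chemPotPlusTT'_zero_one_le_of_bounds' (t : ℝ) {U : ℝ} (hU : 0 ≤ U) {p lo hi : ℝ}
    (hp1 : 1 < p) (hp2 : p < 2) (hlo : lo ≤ energyDensity2D t U 1)
    (hhi : energyDensity2D t U p ≤ hi) :
    chemPotPlusTT' t 0 U 1 ≤ (hi - lo) / (p - 1) :=
  chemPotPlusTT'_le_of_bounds t 0 hU one_pos hp1 hp2 (by rwa [energyDensityTT'_zero])
    (by rwa [energyDensityTT'_zero])

end ThermodynamicLimit

end Literature.MathematicalPhysics.QuantumLattice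

end
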